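import Summits.AtomisticToContinuum.Crystallization.Theorems.GappedShellCensusTornFreeLocalReduction
import Summits.AtomisticToContinuum.Crystallization.Theorems.GappedShellCensusTornFreeStubTfRescale
import Summits.AtomisticToContinuum.Crystallization.Theorems.GappedShellCensusTornFreeTrichotomyUnit
import Summits.AtomisticToContinuum.Crystallization.Theorems.GappedShellCensusTornFreeSparseSplitUnit

/-!
# Skeleton v3.4 — crux `GappedShellCensus.TornFree` (stmt-AtomisticToContinuum-18069), line `Sketch`

Line `Sketch`, lead c1 (continuation of lead 0).

**v3.2: the COMBINATORIAL TRICHOTOMY of a torn bond, content NORMALISED.**  A bond `(y, v)` with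
`c ≤ 3` common neighbours falls in exactly one of three classes, by pure combinatorics of the
commons under ALLGAP (every pair bond-or-far):
* `c ≤ 1` — `stub_tfNoLonelyBondUnit`;  `c = 2` (two distinct commons) — `stub_tfNoTwinBondUnit`
  (v3.4 split of the sparse class by `tf_sparseSplitUnit`, because their numerics differ: two centres
  suffice for `c ≤ 1` by a margin of 1.5 % of the bond length, `c = 2` misses by 8e-4 only);
* `c = 3` with a HUB common bonded to the other two (word `TTW`) — `stub_tfNoHubTriadUnit`;
* `c = 3` with a common bonded to NEITHER of the other two, hence far (`≥ 1.26`) from both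
  (words `TWW`, `WWW`)                                        — `stub_tfNoFarTriadUnit`.
(The bond graph on three commons has a vertex of degree 2 or a vertex of degree 0.)  Each class is a
PURE finite statement, registered at unit scale with the torn bond based at the origin — the form
a certificate and a promoted item want; the geometric consequences proved earlier on this line
(empty `120°` sector p140167/p140320, sector windows p147036, closed half-plane for `c ≤ 2`
p154010, reflex sector behind a hub p153989/p154076, void dichotomy p154537) are LANDED and
importable by whoever certifies a class, but the reduction itself needs none of them.

Composition `TornFree_of` (kernel-checked, this file):
1. LOCALISATION `tf_patch_hyps` (LANDED p150126): the patch `Y ∩ B̄(y, 5a)` of an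
   all-gapped-twelve `Y` is finite, ALLGAP, `≤ 12` everywhere, `= 12` within `3a` of `y`.
2. RESCALING `stub_tfRescale` (LANDED p155348): the general finite statement from the unit-scale
   one via `w ↦ a⁻¹ • (w − y)`.
3. TRICHOTOMY `tf_trichotomyUnit` (LANDED p155445): unit-scale statement from the three classes
   (taken as hypotheses).
4. CONTENT: the four class stubs (certificate-sized; measured per class by the lead's numerics).

All statements over the crux's inline predicates (tolerance `1/50`, gap `63/50`); no definitions.
Stubs are the `sorry`-ed theorems.
-/

noncomputable section

namespace Summit.AtomisticToContinuum.Crystallization.Theorems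

open Literature.Geometry.DiscreteGeometry
open Literature.MathematicalPhysics.StatisticalMechanics
open Summit.AtomisticToContinuum.Crystallization.Theses.GappedShellCensus
open scoped RealInnerProductSpace

/-! ## The three classes at unit scale, torn bond based at the origin (CONTENT) -/

/-- **Stub (CONTENT 1a: no lonely bond).** Let `Y ∋ 0` be a finite configuration in `ℝ³` in which
every pair of distinct points is at distance `≥ 0.98` and either `≤ 1.02` (bond) or `≥ 1.26` (far),
every site has at most twelve bonded neighbours, and every site within `3` of the origin has
exactly twelve.  Then no bond `(0, v)` has at most ONE common neighbour.  (The most certifiable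
class: two-centre allgap numerics at tolerance `1/50` miss feasibility by `0.0149` (`c = 1`) and
`0.0221` (`c = 0`) of the bond length — two twelve-coordinated sites suffice numerically.)
[folklore] -/
theorem stub_tfNoLonelyBondUnit :
    ∀ (Y : Set (EuclideanSpace ℝ (Fin 3))), Y.Finite → (0 : EuclideanSpace ℝ (Fin 3)) ∈ Y →
      (∀ p ∈ Y, ∀ q ∈ Y, p ≠ q → 1 - 1 / 50 ≤ dist p q ∧
        (dist p q ≤ 1 + 1 / 50 ∨ 63 / 50 ≤ dist p q)) →
      (∀ z ∈ Y, {w ∈ Y | w ≠ z ∧ dist z w ≤ 1 + 1 / 50}.ncard ≤ 12) →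
      (∀ z ∈ Y, ‖z‖ ≤ 3 → {w ∈ Y | w ≠ z ∧ dist z w ≤ 1 + 1 / 50}.ncard = 12) →
      ∀ v ∈ Y, v ≠ 0 → ‖v‖ ≤ 1 + 1 / 50 →
        {w ∈ Y | w ≠ 0 ∧ w ≠ v ∧ ‖w‖ ≤ 1 + 1 / 50 ∧ dist v w ≤ 1 + 1 / 50}.ncard ≤ 1 →
        False := by
  sorry

/-- **Stub (CONTENT 1b: no twin bond).** With `Y ∋ 0` as in `stub_tfNoLonelyBondUnit`, no bond
`(0, v)` with at most two common neighbours has two distinct commons `w₁, w₂` (i.e. exactly two;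
words `TW` / `WW`).  (Two-centre allgap numerics at tolerance `1/50` miss feasibility by `0.0008`
only — a third twelve-coordinated site is needed in practice; certificate-sized.) [folklore] -/
theorem stub_tfNoTwinBondUnit :
    ∀ (Y : Set (EuclideanSpace ℝ (Fin 3))), Y.Finite → (0 : EuclideanSpace ℝ (Fin 3)) ∈ Y →
      (∀ p ∈ Y, ∀ q ∈ Y, p ≠ q → 1 - 1 / 50 ≤ dist p q ∧
        (dist p q ≤ 1 + 1 / 50 ∨ 63 / 50 ≤ dist p q)) →
      (∀ z ∈ Y, {w ∈ Y | w ≠ z ∧ dist z w ≤ 1 + 1 / 50}.ncard ≤ 12) →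
      (∀ z ∈ Y, ‖z‖ ≤ 3 → {w ∈ Y | w ≠ z ∧ dist z w ≤ 1 + 1 / 50}.ncard = 12) →
      ∀ v ∈ Y, v ≠ 0 → ‖v‖ ≤ 1 + 1 / 50 →
        {w ∈ Y | w ≠ 0 ∧ w ≠ v ∧ ‖w‖ ≤ 1 + 1 / 50 ∧ dist v w ≤ 1 + 1 / 50}.ncard ≤ 2 →
        ∀ w₁ ∈ Y, ∀ w₂ ∈ Y,
          w₁ ≠ 0 → w₁ ≠ v → ‖w₁‖ ≤ 1 + 1 / 50 → dist v w₁ ≤ 1 + 1 / 50 →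
          w₂ ≠ 0 → w₂ ≠ v → ‖w₂‖ ≤ 1 + 1 / 50 → dist v w₂ ≤ 1 + 1 / 50 →
          w₁ ≠ w₂ → False := by
  sorry

-- Glue `tf_sparseSplitUnit` LANDED: GappedShellCensusTornFreeSparseSplitUnit.lean (p157060), imported.

/-- **Stub (CONTENT 2: no hub triad).** With `Y ∋ 0` as in `stub_tfNoSparseBondUnit`, no bond
`(0, v)` with at most three common neighbours has three distinct commons `w₁, w₂, w₃` with the hub
`w₂` bonded (`≤ 1.02`) to both `w₁` and `w₃` (word `TTW`: two quasi-tetrahedral sectors `≤ 75.5°`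
each, empty sector `≥ 209°` — the reflex, S8-hole tear).  Certificate-sized. [folklore] -/
theorem stub_tfNoHubTriadUnit :
    ∀ (Y : Set (EuclideanSpace ℝ (Fin 3))), Y.Finite → (0 : EuclideanSpace ℝ (Fin 3)) ∈ Y →
      (∀ p ∈ Y, ∀ q ∈ Y, p ≠ q → 1 - 1 / 50 ≤ dist p q ∧
        (dist p q ≤ 1 + 1 / 50 ∨ 63 / 50 ≤ dist p q)) →
      (∀ z ∈ Y, {w ∈ Y | w ≠ z ∧ dist z w ≤ 1 + 1 / 50}.ncard ≤ 12) →
      (∀ z ∈ Y, ‖z‖ ≤ 3 → {w ∈ Y | w ≠ z ∧ dist z w ≤ 1 + 1 / 50}.ncard = 12) →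
      ∀ v ∈ Y, v ≠ 0 → ‖v‖ ≤ 1 + 1 / 50 →
        {w ∈ Y | w ≠ 0 ∧ w ≠ v ∧ ‖w‖ ≤ 1 + 1 / 50 ∧ dist v w ≤ 1 + 1 / 50}.ncard ≤ 3 →
        ∀ w₁ ∈ Y, ∀ w₂ ∈ Y, ∀ w₃ ∈ Y,
          w₁ ≠ 0 → w₁ ≠ v → ‖w₁‖ ≤ 1 + 1 / 50 → dist v w₁ ≤ 1 + 1 / 50 →
          w₂ ≠ 0 → w₂ ≠ v → ‖w₂‖ ≤ 1 + 1 / 50 → dist v w₂ ≤ 1 + 1 / 50 →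
          w₃ ≠ 0 → w₃ ≠ v → ‖w₃‖ ≤ 1 + 1 / 50 → dist v w₃ ≤ 1 + 1 / 50 →
          w₁ ≠ w₂ → w₁ ≠ w₃ → w₂ ≠ w₃ →
          dist w₁ w₂ ≤ 1 + 1 / 50 → dist w₂ w₃ ≤ 1 + 1 / 50 →
          False := by
  sorry

/-- **Stub (CONTENT 3: no far triad).** With `Y ∋ 0` as in `stub_tfNoSparseBondUnit`, no bond
`(0, v)` with at most three common neighbours has three distinct commons `w₁, w₂, w₃` with `w₃` far
(`≥ 1.26`) from both `w₁` and `w₂` (words `TWW`, `WWW`; the vacancy-like tear — fcc/hcp with one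
common removed has `T + O = 180°` — and the `197°` allgap two-centre cluster).  Certificate-sized.
[folklore] -/
theorem stub_tfNoFarTriadUnit :
    ∀ (Y : Set (EuclideanSpace ℝ (Fin 3))), Y.Finite → (0 : EuclideanSpace ℝ (Fin 3)) ∈ Y →
      (∀ p ∈ Y, ∀ q ∈ Y, p ≠ q → 1 - 1 / 50 ≤ dist p q ∧
        (dist p q ≤ 1 + 1 / 50 ∨ 63 / 50 ≤ dist p q)) →
      (∀ z ∈ Y, {w ∈ Y | w ≠ z ∧ dist z w ≤ 1 + 1 / 50}.ncard ≤ 12) →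
      (∀ z ∈ Y, ‖z‖ ≤ 3 → {w ∈ Y | w ≠ z ∧ dist z w ≤ 1 + 1 / 50}.ncard = 12) →
      ∀ v ∈ Y, v ≠ 0 → ‖v‖ ≤ 1 + 1 / 50 →
        {w ∈ Y | w ≠ 0 ∧ w ≠ v ∧ ‖w‖ ≤ 1 + 1 / 50 ∧ dist v w ≤ 1 + 1 / 50}.ncard ≤ 3 →
        ∀ w₁ ∈ Y, ∀ w₂ ∈ Y, ∀ w₃ ∈ Y,
          w₁ ≠ 0 → w₁ ≠ v → ‖w₁‖ ≤ 1 + 1 / 50 → dist v w₁ ≤ 1 + 1 / 50 →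
          w₂ ≠ 0 → w₂ ≠ v → ‖w₂‖ ≤ 1 + 1 / 50 → dist v w₂ ≤ 1 + 1 / 50 →
          w₃ ≠ 0 → w₃ ≠ v → ‖w₃‖ ≤ 1 + 1 / 50 → dist v w₃ ≤ 1 + 1 / 50 →
          w₁ ≠ w₂ → w₁ ≠ w₃ → w₂ ≠ w₃ →
          63 / 50 ≤ dist w₁ w₃ → 63 / 50 ≤ dist w₂ w₃ →
          False := by
  sorry

-- Stub `stub_tfRescale` LANDED: GappedShellCensusTornFreeStubTfRescale.lean (p155348), imported.
-- Glue `tf_trichotomyUnit` LANDED: GappedShellCensusTornFreeTrichotomyUnit.lean (p155445), imported.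

/-! ## Composition -/

/-- **Composition (kernel-checked).** The crux `TornFree` BY NAME: localise to the finite ALLGAP
patch `Y ∩ B̄(y, 5a)` (`tf_patch_hyps`, landed p150126), rescale to unit scale about `y`
(`stub_tfRescale`), and split by the trichotomy `tf_trichotomyUnit`. -/
theorem TornFree_of : TornFree := by
  intro Y a ha hgood y hy v hv hvy hdv
  by_contra hlt
  push Not at hlt
  have h3 : {w ∈ Y | w ≠ y ∧ w ≠ v ∧ dist y w ≤ a * (1 + 1 / 50) ∧
      dist v w ≤ a * (1 + 1 / 50)}.ncard ≤ 3 := by omega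
  -- the finite patch
  obtain ⟨hfin, hgap, hle, htw⟩ := tf_patch_hyps ha hgood y
  have hyY' : y ∈ {z ∈ Y | dist y z ≤ a * 5} := ⟨hy, by rw [dist_self]; positivity⟩
  have hvY' : v ∈ {z ∈ Y | dist y z ≤ a * 5} := ⟨hv, hdv.trans (by nlinarith)⟩
  have hsubC : {w ∈ {z ∈ Y | dist y z ≤ a * 5} | w ≠ y ∧ w ≠ v ∧ dist y w ≤ a * (1 + 1 / 50) ∧
      dist v w ≤ a * (1 + 1 / 50)} ⊆ {w ∈ Y | w ≠ y ∧ w ≠ v ∧ dist y w ≤ a * (1 + 1 / 50) ∧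
      dist v w ≤ a * (1 + 1 / 50)} := fun w hw => ⟨hw.1.1, hw.2⟩
  have h3' : {w ∈ {z ∈ Y | dist y z ≤ a * 5} | w ≠ y ∧ w ≠ v ∧ dist y w ≤ a * (1 + 1 / 50) ∧
      dist v w ≤ a * (1 + 1 / 50)}.ncard ≤ 3 :=
    (Set.ncard_le_ncard hsubC (tf_commons_finite (hgood y hy).1)).trans h3
  exact stub_tfRescale
    (tf_trichotomyUnit (tf_sparseSplitUnit stub_tfNoLonelyBondUnit stub_tfNoTwinBondUnit)
      stub_tfNoHubTriadUnit stub_tfNoFarTriadUnit)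
    _ a ha hfin hgap hle y hyY' htw v hvY' hvy hdv h3'

end Summit.AtomisticToContinuum.Crystallization.Theorems

end
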